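import Literature.MathematicalPhysics.QuantumFieldTheory.Balaban1983to89.B15Prop1LocalChartFromThm1AtBase
import Literature.MathematicalPhysics.QuantumFieldTheory.Balaban1983to89.Node00.MultiScaleFibreChartB

/-!
# `Balaban1983to89.B15Prop1LocalChartFromThm1AtBase` — [Balaban1985Variational] = «[15]», Thm 1 p. 279 («there exists exactly one orbit … it is a minimum»), (4) p. 278 — **BOND-DATUM EDITION** (`…B15Prop1LocalChartFromThm1AtBaseB`, USED DECLARATIONS ONLY): the print-datum ([Balaban1984PropagatorsII] (2.3)) twins of the declarations of `B15Prop1LocalChartFromThm1AtBase` that N12's junction of record v14ᴸ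
uses with a datum-bearing statement (`agreeOn_iff_datum_eq`) — class (γ) of dag-n12-c's census-by-declaration v2 (bus [DAGN12C-G35], 2026-08-30).  GENERATOR (block-extracted from the
parent's tree bytes by HOME `lean/g35/gen/gen_blocks.py`): namespace `…B`, SAME names, `DetSet ↦ BDetSet` (F0a), `AgreeOn ↦ AgreeOnB`, `IsMinimizer ↦ IsMinimizerB`, `bondsOf (𝐁 j) ↦ 𝔅 j`, `constrCard ∕
constrEnum ∕ ConstrSet ∕ msChart ↦ …B` (lane `Node00/MultiScaleFibreChartB`), `IsCritOnFibre ∕ IsFibreChartNear ↦ …B`; proofs VERBATIM; the parent's other (datum-free) declarations REUSED by `open`.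

statement-level skeleton of published theorems with citation tags; proofs where landed; nothing here is a claim about
the Yang–Mills mass gap

Cell `pub-ymgap` (HUMAN RULINGS D-0062 ∕ D-0149), lane `pub-ymgap-dag-n12-c` g35 (R134 seat (a), N12 = [B15], s1, lane owner); `--kind proof --supports` K1⁹ `stmt-QuantumFields-27364`; count-neutral.
THEOREMS ONLY (0 `def`, 0 `instance`, 0 `sorry`).  HONESTY GUARD (director-ym №338 (5)): PURELY ADDITIVE — the parent stays landed and true on its own text; nothing in it is edited; no displayed
premise of any consumer is deleted or weakened; every hypothesis stays a hypothesis.  Nothing of Bałaban's analysis asserted; N12 NOT discharged; K0⁷ ∕ K1⁹ NOT closed; one finite 𝕋⁴ programme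
at fixed ε — nothing continuum ∕ ℝ⁴ ∕ OS; the Yang–Mills mass gap (Clay) is NOT proved by any of this.

PARENT's DOCSTRING (mathematics and citations; read `𝐁` as the bond datum `𝔅`):
# `Balaban1983to89.B15Prop1LocalChartFromThm1AtBase` — [Balaban1985Variational] = «[15]», Thm 1 p. 279 («there exists exactly one orbit … it is a minimum»), (4) p. 278
# (the residual gauge group «u(y) = 1 for y ∈ 𝔅_k»), Prop. 8 p. 305, Sect. F p. 300; [Balaban1988Convergent] = «[III]», (2.10)–(2.12) p. 256; [Balaban1985Averaging] (11) p. 19: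
# THE RECORD JUNCTION — the letters `hcritT` AND `hT1u` of the w1 lineage's chart theorem `B15Prop1LocalChartAtBaseField.exists_localChart_at_baseField` DISCHARGED AT
# `Crit := IsMinimizer` from THEOREM 1 AT THE BASE DATUM + a residual gauge section + [15] Prop. 8 at chart points (the abstract compactness theorem
# `B15Prop1MinimiserFromBaseUniqueness.htransfer_isMin_of_thm1AtBase` instantiated at `SU(2)^{bonds}`, the Wilson action, the `𝐁`-restricted multi-scale averages and the
# residual gauge group; local uniqueness from `ConstrainedCriticalPointLocallyUnique` through the logarithmic datum coordinates)

Honest framing: statement-level skeleton of published theorems with citation tags; proofs where landed; nothing here is a claim about the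
Yang–Mills mass gap.  Cell `pub-ymgap`, HUMAN RULING D-0149 (width seats), seat `pub-ymgap-dag-n12-w1` (g3; N12 = [B15]; U1a⁺ of the w1 lineage, rule (ii)); `--kind proof
--supports` the K1 item of record; count-neutral; N12 NOT discharged; finite 𝕋⁴ at fixed ε; nothing continuum ∕ ℝ⁴ ∕ OS ∕ mass-gap ∕ Clay.

WHY.  `exists_localChart_at_baseField` displays, per base field, SIX letters: `hcrit`, `honto`, `hnondeg` (β), `hclass`, `hcritT` ([15] Sect. F at an abstract `Crit`) and `hT1u` ([15]
Thm 1's uniqueness clause FOR ALL NEARBY DATA).  With `Crit Q' U' := IsMinimizer av reg 𝔹 (avgFamily av Q') U'`, `hT1u` is the identity and `hcritT` follows (§3) from the abstract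
`htransfer_isMin_of_thm1AtBase` at the record's objects: `X := GaugeField P 0 SU2` (compact), `A := wilsonAction4` (continuous, gauge invariant: `wilsonAction4_gaugeAct'`),
`D U := (↑(Ū^{j}(U)(c)))_{(j,c) ∈ constrained bonds of 𝐁}` (§1: `AgreeOn 𝐁 ⟺ D =`, continuous at every guarded configuration by `coeField_iter_eq_iterMh` ∕ `differentiableAt_iterMh`
∕ `eventually_smallBelow`, invariant under RESIDUAL gauge transformations by the covariance `iter_gaugeAct` — [Balaban1985Averaging] (11)), `Res :=` the actions of gauge
transformations trivial at the block-tower sites of the constrained bonds ([15] (4); the (σ4) shape of dag-n12-w6's `B15Prop1AxialGaugeSectionOfForest`), `ι := coeField` (inducing,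
injective), `χ x := expMulC ↑x ↑U₀` on the slice, `Â := Re` of the complex Wilson action (`B15Prop1ComplexWilsonAction`), and (U) from
`ConstrainedCriticalPointLocallyUnique.exists_nhds_critical_unique` for the analytic slice action ∕ slice datum (`analyticAt_sliceAction` ∕ `analyticAt_sliceDatum`) through the
dictionary `Φ₀ x = (logCoordC (W_i⋆ · D(U')_i))_i` at a guarded chart point `χ x = ↑U'`.  AFTER THIS FILE the per-base-field letters of the (J0′)∕(K′) road are: `hcrit`, `honto`,
(β) `hnondeg`, `hclass` (discharged at NODE 00's class by `B15Prop1ClassOpenAtRecord`), and — replacing {(E), `hcritT`, `hT1u`} — (T1@q₀) THEOREM 1 AT THE BASE DATUM («every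
configuration of the closed-reading class `reg'` on the base fibre with action `≤ A(U₀)` is a residual translate of `U₀`»), (S) a RESIDUAL GAUGE SECTION near `U₀` into the slice chart
(dag-n12-w6's (σ1)–(σ4) ∕ forest gauge + `contDiff_pathGaugeAct` supply it — successor junction), (P8) [15] Prop. 8 at chart points (a minimiser `exp(x)·U₀` over `reg`, `x` near `0`, is
Lagrange-critical in the slice coordinates; the base-point case is `B15Prop1BaseCriticalityFromMinimiser.hcrit_of_isMinimizer`), and the three CLASS facts `IsClosed reg'`,
`closure reg ⊆ reg'`, `reg' ⊆ {guarded below k}`.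

CONTENTS (theorems only; no `def`, no `instance`, no `sorry`).  §1 `agreeOn_iff_datum_eq`, `datum_gaugeAct_of_residual`, `continuousAt_datum`.  §2 ★★★ `hcritT_isMinimizer_of_thm1AtBase`
(the `hcritT` binder of `exists_localChart_at_baseField` at `Crit := IsMinimizer`).  §3 ★★★ `exists_localChart_at_baseField_of_thm1AtBase` (the chart theorem with {`hcritT`, `hT1u`} ↦
{(T1@q₀), (S), (P8), class facts}).
HONEST SCOPE: topology ∕ bookkeeping; (T1@q₀), (S), (P8), `hcrit`, `honto`, `hnondeg` stay DISPLAYED as hypotheses — print's analysis, not asserted; count-neutral; N12 NOT discharged; the YM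
mass gap (Clay) is NOT proved by any of this — R4 closes only the conditional finite-𝕋⁴ rung `BalabanLadder.UV`.
-/


noncomputable section

namespace Literature.MathematicalPhysics.QuantumFieldTheory.Balaban1983to89.B15Prop1LocalChartFromThm1AtBaseB

open B15Prop1LocalChartFromThm1AtBase


open Set Metric Filter
open scoped Topology
open Literature.MathematicalPhysics.QuantumFieldTheory.Balaban1983to89.Node00 (SU coeField coeField_apply SmallBelow ConstrSetB constrCardB constrEnumB star_coe_mul_coe_SU)
open B15AveragingHolomorphic (iterMh coeField_iter_eq_iterMh differentiableAt_iterMh)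
open B15ComplexifiedDatumFamily (conjVec)
open B15SU2ChartHolomorphic (expMulC logCoordC differentiableAt_logCoordC)
open B15Prop1StateChartSU2 (differentiable_expMulC_right)
open B15Prop1DatumCoordinates (eventually_smallBelow expMulC_zero_left logCoordC_one)
open B15Prop1ComplexWilsonAction (contDiffAt_actionSum actionSum_expMulC_cplxVec)
open B15Prop1CriticalChartFromIFT (cplxVec_zero)
open B15Prop1ClassOpenAtRecord (isInducing_coeField)
open B15Prop1LocalChartAtBaseField (exists_localChart_at_baseField)
open B15Prop1SliceNondegeneracyFromRealCoercive (analyticAt_sliceAction analyticAt_sliceDatum)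
open B15Prop1MinimiserFromBaseUniqueness (htransfer_isMin_of_thm1AtBase)
open Literature.Analysis.Calculus.ConstrainedCriticalPointLocallyUnique (exists_nhds_critical_unique)
open B14Eq16FaddeevPopov (wilsonAction4_gaugeAct')
open B16Thm1BaseAtRecord11 (continuous_wilsonAction4_SU)
open B12ContinuousTransportInvariance (continuous_gaugeAct_SU)
open B16Sect1Backgrounds (toMS iter_gaugeAct expMul expMul_zero)
open B15Prop1AnalyticExtClause (cplxVec)
open B15Prop1ChartSU2 (su2Chart)
open ExpMeanLog (expMeanLogSU)
open BlockAveraging (blockAvg)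
open T4CubeChartGnomonic (SU2)
open T4Continuum B15DeterminingSets B15DeterminingSetsB GaugeField
open scoped Matrix.Norms.L2Operator

variable {P : Params}



section
variable (𝔅 : BDetSet P) (k : ℕ)

/-- **`AgreeOn 𝐁` IS EQUALITY OF THE DATUM VECTOR**: for a determining set with no member above level `k`, two multi-scale fields agree on `𝐁` iff their (matrix) values at the
enumerated constrained bonds of levels `≤ k` coincide ([III] (2.10): «V = V_j on Γ_j»). [cite: Balaban1988Convergent, (2.10) p.256] -/
theorem agreeOn_iff_datum_eq (h𝔅 : ∀ j, k < j → 𝔅 j = ∅) (V W : MSField P SU2) :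
    AgreeOnB 𝔅 V W ↔
      (fun i : Fin (constrCardB 𝔅 k) => ((V ((constrEnumB 𝔅 k).symm i).1 ((constrEnumB 𝔅 k).symm i).2.1 : SU2) : Matrix (Fin 2) (Fin 2) ℂ)) =
        fun i => ((W ((constrEnumB 𝔅 k).symm i).1 ((constrEnumB 𝔅 k).symm i).2.1 : SU2) : Matrix (Fin 2) (Fin 2) ℂ) := by
  constructor
  · intro h
    funext i
    exact congrArg (fun g : SU2 => (g : Matrix (Fin 2) (Fin 2) ℂ)) (h _ _ ((constrEnumB 𝔅 k).symm i).2.2)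
  · intro heq j c hc
    by_cases hjk : k < j
    · exfalso
      have h0 : 𝔅 j = ∅ := h𝔅 j hjk
      rw [h0] at hc; exact hc
    · have hj : j ≤ k := Nat.le_of_not_lt hjk
      let s₀ : ConstrSetB 𝔅 k := ⟨⟨j, Nat.lt_succ_of_le hj⟩, c, hc⟩
      have hi : ((V ((constrEnumB 𝔅 k).symm (constrEnumB 𝔅 k s₀)).1 ((constrEnumB 𝔅 k).symm (constrEnumB 𝔅 k s₀)).2.1 : SU2) : Matrix (Fin 2) (Fin 2) ℂ) =
          ((W ((constrEnumB 𝔅 k).symm (constrEnumB 𝔅 k s₀)).1 ((constrEnumB 𝔅 k).symm (constrEnumB 𝔅 k s₀)).2.1 : SU2) : Matrix (Fin 2) (Fin 2) ℂ) :=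
        congrFun heq (constrEnumB 𝔅 k s₀)
      rw [Equiv.symm_apply_apply] at hi
      exact Subtype.ext hi

end

end Literature.MathematicalPhysics.QuantumFieldTheory.Balaban1983to89.B15Prop1LocalChartFromThm1AtBaseB

end
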